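import Literature.LinearAlgebra.Alternating.WedgeOne
import Mathlib.LinearAlgebra.Span.Basic
import HarnessLib

/-!
# Wedge monomials span the alternating maps (exterior-algebra basis, spanning half)

Companion of `Literature/LinearAlgebra/Alternating/WedgeOne.lean` (the wedge `θ ∧ η` with a
constant `1`-form and the canonical anticommutation relations). For a family of `1`-forms
`θ : σ → (E →L[𝕜] 𝕜')` and a `0`-form `c` we define the **wedge monomials**
`wedgeWord θ c k w = θ_{w 0} ∧ θ_{w 1} ∧ ⋯ ∧ θ_{w (k-1)} ∧ c` (`w : Fin k → σ`) and prove: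

* `sum_wedgeOne_curryLeft` — the **Euler (number-operator) identity**: for a dual pair
  (`Σᵢ θᵢ(w) vᵢ = w`), `Σᵢ θᵢ ∧ (vᵢ ⌟ f) = (n + 1) f` on `(n+1)`-forms; this is Mathlib's
  `ContinuousAlternatingMap.alternatizeUncurryFin_curryLeft` read through `wedgeOne`;
* `span_wedgeWord_eq_top` — hence, by induction on the degree, **the wedge monomials in the
  coordinate forms of a dual pair span all alternating `k`-forms** (Warner (1983), 2.6: the
  `θ_{i₁} ∧ ⋯ ∧ θ_{i_k}` span, indeed form a basis of, `Λᵏ`); over `𝕜'`-valued forms the monomials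
  ending in the constant `1` suffice (`span_wedgeWord_const_eq_top`);
* `wedgeWord_mem_span_of_mem_span` — **change of frame**: monomials in `1`-forms `θ'ⱼ` lying in the
  `𝕜'`-span of the `θᵢ` lie in the span of the `θ`-monomials (multilinearity of `∧`).

Consumer: the `(p,q)`-monomials `dz_P ∧ dz̄_Q` on `ℂ^ι` (`Literature/Analysis/Complex/PQMonomials.lean`),
towards the Hodge numbers of complex tori (Lange–Birkenhake (1992), Thm. 1.1.21 (b)). Linear
independence of the monomials with increasing words is not needed there and not proved here.

## References

* F. W. Warner, *Foundations of Differentiable Manifolds and Lie Groups* (1983), 2.6 (basis of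
  `Λ_k(V)` from a basis of `V*`). [Warner1983]
-/

noncomputable section

open ContinuousAlternatingMap Function

namespace Literature.LinearAlgebra.Alternating

variable {𝕜 : Type*} [NontriviallyNormedField 𝕜] {𝕜' : Type*} [NormedField 𝕜']
  [NormedAlgebra 𝕜 𝕜'] {E : Type*} [NormedAddCommGroup E] [NormedSpace 𝕜 E]
  {F : Type*} [NormedAddCommGroup F] [NormedSpace 𝕜 F] [NormedSpace 𝕜' F]
  [IsScalarTower 𝕜 𝕜' F] {n : ℕ}

/-! ### Wedge monomials -/

/-- **Wedge monomial** `θ_{w 0} ∧ θ_{w 1} ∧ ⋯ ∧ θ_{w (k-1)} ∧ c` of a word `w : Fin k → σ` in a family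
of constant `1`-forms `θ : σ → (E →L[𝕜] 𝕜')`, ending in the `0`-form `c` (iterated `wedgeOne`,
right-nested). [cite: Warner1983, 2.6] -/
def wedgeWord {σ : Type*} (θ : σ → (E →L[𝕜] 𝕜')) (c : E [⋀^Fin 0]→L[𝕜] F) :
    (k : ℕ) → (Fin k → σ) → E [⋀^Fin k]→L[𝕜] F
  | 0, _ => c
  | k + 1, w => wedgeOne (θ (w 0)) (wedgeWord θ c k (Fin.tail w))

variable {σ : Type*} (θ : σ → (E →L[𝕜] 𝕜')) (c : E [⋀^Fin 0]→L[𝕜] F)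

/-- The empty monomial is the `0`-form `c`. [folklore] -/
@[simp] theorem wedgeWord_zero (w : Fin 0 → σ) : wedgeWord θ c 0 w = c := rfl

/-- `θ_{w 0} ∧ (θ_{w 1} ∧ ⋯)`. [folklore] -/
theorem wedgeWord_succ {k : ℕ} (w : Fin (k + 1) → σ) :
    wedgeWord θ c (k + 1) w = wedgeOne (θ (w 0)) (wedgeWord θ c k (Fin.tail w)) := rfl

/-- Prepending a letter: `θᵢ ∧ (θ_w ∧ c) = θ_{i :: w} ∧ c`. [folklore] -/
theorem wedgeOne_wedgeWord {k : ℕ} (i : σ) (w : Fin k → σ) :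
    wedgeOne (θ i) (wedgeWord θ c k w) = wedgeWord θ c (k + 1) (Fin.cons i w) := by
  rw [wedgeWord_succ, Fin.cons_zero, Fin.tail_cons]

/-- The `𝕜'`-span of the wedge monomials of length `k` (fixed `0`-form `c`). [folklore] -/
def wedgeWordSpan (k : ℕ) : Submodule 𝕜' (E [⋀^Fin k]→L[𝕜] F) :=
  Submodule.span 𝕜' (Set.range (wedgeWord θ c k))

/-- Monomials lie in their span. [folklore] -/
theorem wedgeWord_mem_wedgeWordSpan {k : ℕ} (w : Fin k → σ) :
    wedgeWord θ c k w ∈ wedgeWordSpan θ c k :=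
  Submodule.subset_span ⟨w, rfl⟩

/-- `θᵢ ∧ ·` maps the span of the `k`-monomials into the span of the `(k+1)`-monomials.
[folklore] -/
theorem wedgeOne_mem_wedgeWordSpan {k : ℕ} (i : σ) {η : E [⋀^Fin k]→L[𝕜] F}
    (hη : η ∈ wedgeWordSpan θ c k) : wedgeOne (θ i) η ∈ wedgeWordSpan θ c (k + 1) := by
  have hmap : (wedgeWordSpan θ c k).map
      ((wedgeOneL (θ i) : (E [⋀^Fin k]→L[𝕜] F) →L[𝕜'] _).toLinearMap) ≤ wedgeWordSpan θ c (k + 1) := by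
    rw [wedgeWordSpan, Submodule.map_span_le]
    rintro _ ⟨w, rfl⟩
    change wedgeOne (θ i) (wedgeWord θ c k w) ∈ _
    rw [wedgeOne_wedgeWord]
    exact wedgeWord_mem_wedgeWordSpan θ c _
  exact hmap (Submodule.mem_map_of_mem hη)

/-- `θ' ∧ ·` for ANY `θ'` in the `𝕜'`-span of the `θᵢ` maps the span of the `k`-monomials into the
span of the `(k+1)`-monomials (`∧` is linear in the `1`-form). [folklore] -/
theorem wedgeOne_mem_wedgeWordSpan_of_mem_span {k : ℕ} {θ' : E →L[𝕜] 𝕜'}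
    (hθ' : θ' ∈ Submodule.span 𝕜' (Set.range θ)) {η : E [⋀^Fin k]→L[𝕜] F}
    (hη : η ∈ wedgeWordSpan θ c k) : wedgeOne θ' η ∈ wedgeWordSpan θ c (k + 1) := by
  induction hθ' using Submodule.span_induction with
  | mem x hx =>
    obtain ⟨i, rfl⟩ := hx
    exact wedgeOne_mem_wedgeWordSpan θ c i hη
  | zero =>
    have h0 : wedgeOne (0 : E →L[𝕜] 𝕜') η = 0 := by ext v; simp [wedgeOne_apply]
    rw [h0]
    exact Submodule.zero_mem _
  | add x y _ _ hx hy =>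
    rw [wedgeOne_add_left]
    exact Submodule.add_mem _ hx hy
  | smul a x _ hx =>
    rw [wedgeOne_smul_left]
    exact Submodule.smul_mem _ a hx

/-- **Change of frame.** If every `θ'ⱼ` lies in the `𝕜'`-span of the `θᵢ`, every `θ'`-monomial lies
in the span of the `θ`-monomials of the same length. [folklore] -/
theorem wedgeWord_mem_span_of_mem_span {σ' : Type*} {θ' : σ' → (E →L[𝕜] 𝕜')}
    (hθ' : ∀ j, θ' j ∈ Submodule.span 𝕜' (Set.range θ)) :
    ∀ (k : ℕ) (w : Fin k → σ'), wedgeWord θ' c k w ∈ wedgeWordSpan θ c k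
  | 0, w => by
    rw [wedgeWord_zero]
    exact Submodule.subset_span ⟨Fin.elim0, rfl⟩
  | k + 1, w => by
    rw [wedgeWord_succ]
    exact wedgeOne_mem_wedgeWordSpan_of_mem_span θ c (hθ' (w 0))
      (wedgeWord_mem_span_of_mem_span hθ' k (Fin.tail w))

/-! ### The Euler identity and spanning -/

/-- `𝕜`-valued versus `𝕜'`-valued coordinate forms: `(θ · 1_{𝕜'}) ∧ η = θ ∧ η`. [folklore] -/
theorem wedgeOne_smulRight_one (θ₀ : E →L[𝕜] 𝕜) (η : E [⋀^Fin n]→L[𝕜] F) :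
    wedgeOne (θ₀.smulRight (1 : 𝕜')) η = wedgeOne θ₀ η := by
  ext v
  simp [wedgeOne_apply]

/-- **Euler's identity (the number operator).** For a dual pair `θᵢ : E →L[𝕜] 𝕜`, `vᵢ : E`
(`Σᵢ θᵢ(·) vᵢ = id`, stated as an identity of continuous linear maps) and an `(n+1)`-form `f`:
`Σᵢ θᵢ ∧ (vᵢ ⌟ f) = (n + 1) • f`. (Mathlib's `alternatizeUncurryFin_curryLeft`,
`A(w ↦ w ⌟ f) = (n+1) f`, with `w ↦ w ⌟ f = Σᵢ θᵢ(w) (vᵢ ⌟ f)`.) [cite: Warner1983, 2.11] -/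
theorem sum_wedgeOne_curryLeft {ι' : Type*} [Fintype ι'] (θ₀ : ι' → (E →L[𝕜] 𝕜)) (v : ι' → E)
    (h : ∑ i, (θ₀ i).smulRight (v i) = ContinuousLinearMap.id 𝕜 E)
    (f : E [⋀^Fin (n + 1)]→L[𝕜] F) :
    ∑ i, wedgeOne (θ₀ i) (f.curryLeft (v i)) = (n + 1) • f := by
  have h' : ∀ w, ∑ i, θ₀ i w • v i = w := fun w ↦ by
    simpa using congrArg (fun T : E →L[𝕜] E ↦ T w) h
  have key : ∑ i, (θ₀ i).smulRight (f.curryLeft (v i)) = f.curryLeft := by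
    ext w u
    have hw := congrArg (fun x ↦ f.curryLeft x u) (h' w)
    simp only [_root_.map_sum, map_smul] at hw
    simpa using hw
  calc ∑ i, wedgeOne (θ₀ i) (f.curryLeft (v i))
      = ∑ i, alternatizeUncurryFinCLM 𝕜 E F ((θ₀ i).smulRight (f.curryLeft (v i))) := by
        simp only [alternatizeUncurryFinCLM_apply]; rfl
    _ = alternatizeUncurryFin f.curryLeft := by
        rw [← _root_.map_sum, key, alternatizeUncurryFinCLM_apply]
    _ = (n + 1) • f := alternatizeUncurryFin_curryLeft f

/-- **The wedge monomials span** (Warner (1983), 2.6). For a dual pair `(θᵢ, vᵢ)` as above, the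
monomials `θ_{w 0} ∧ ⋯ ∧ θ_{w (k-1)} ∧ c`, over all words `w : Fin k → ι'` and all `0`-forms `c`,
span the `𝕜'`-module of alternating `k`-forms `E [⋀^Fin k]→L[𝕜] F` (induction on `k` by Euler's
identity: `f = (k+1)⁻¹ Σᵢ θᵢ ∧ (vᵢ ⌟ f)`). [cite: Warner1983, 2.6] -/
theorem span_wedgeWord_eq_top [CharZero 𝕜'] {ι' : Type*} [Fintype ι'] (θ₀ : ι' → (E →L[𝕜] 𝕜))
    (v : ι' → E) (h : ∑ i, (θ₀ i).smulRight (v i) = ContinuousLinearMap.id 𝕜 E) :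
    ∀ k : ℕ, Submodule.span 𝕜'
      {η : E [⋀^Fin k]→L[𝕜] F | ∃ (c : E [⋀^Fin 0]→L[𝕜] F) (w : Fin k → ι'),
        wedgeWord (fun i ↦ (θ₀ i).smulRight (1 : 𝕜')) c k w = η} = ⊤
  | 0 => by
    refine eq_top_iff.2 fun f _ ↦ Submodule.subset_span ⟨f, Fin.elim0, rfl⟩
  | k + 1 => by
    set θ : ι' → (E →L[𝕜] 𝕜') := fun i ↦ (θ₀ i).smulRight (1 : 𝕜') with hθ
    refine eq_top_iff.2 fun f _ ↦ ?_
    -- each `vᵢ ⌟ f` is in the span of the `k`-monomials, and `θᵢ ∧ ·` raises the length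
    have hstep : ∀ i, wedgeOne (θ i) (f.curryLeft (v i)) ∈ Submodule.span 𝕜'
        {η : E [⋀^Fin (k + 1)]→L[𝕜] F | ∃ (c : E [⋀^Fin 0]→L[𝕜] F) (w : Fin (k + 1) → ι'),
          wedgeWord θ c (k + 1) w = η} := by
      intro i
      have hf : f.curryLeft (v i) ∈ Submodule.span 𝕜'
          {η : E [⋀^Fin k]→L[𝕜] F | ∃ (c : E [⋀^Fin 0]→L[𝕜] F) (w : Fin k → ι'),
            wedgeWord θ c k w = η} := by
        rw [span_wedgeWord_eq_top θ₀ v h k]; exact Submodule.mem_top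
      refine Submodule.span_induction (p := fun η _ ↦ wedgeOne (θ i) η ∈ _) ?_ ?_ ?_ ?_ hf
      · rintro _ ⟨c, w, rfl⟩
        rw [wedgeOne_wedgeWord]
        exact Submodule.subset_span ⟨c, Fin.cons i w, rfl⟩
      · rw [wedgeOne_zero]; exact Submodule.zero_mem _
      · intro x y _ _ hx hy
        rw [wedgeOne_add]; exact Submodule.add_mem _ hx hy
      · intro a x _ hx
        rw [wedgeOne_smul]; exact Submodule.smul_mem _ a hx
    -- Euler: `f = (k+1)⁻¹ • Σᵢ θᵢ ∧ (vᵢ ⌟ f)`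
    have heuler : ((k : 𝕜') + 1)⁻¹ • ∑ i, wedgeOne (θ i) (f.curryLeft (v i)) = f := by
      have h1 : ∑ i, wedgeOne (θ i) (f.curryLeft (v i)) = ((k : 𝕜') + 1) • f := by
        simp only [hθ, wedgeOne_smulRight_one]
        rw [sum_wedgeOne_curryLeft θ₀ v h f, ← Nat.cast_succ, Nat.cast_smul_eq_nsmul]
      rw [h1, smul_smul, inv_mul_cancel₀ (by exact_mod_cast Nat.succ_ne_zero k), one_smul]
    rw [← heuler]
    exact Submodule.smul_mem _ _ (Submodule.sum_mem _ fun i _ ↦ hstep i)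

/-- **Spanning by the monomials ending in `1`** (`𝕜'`-valued forms): the `θ_{w 0} ∧ ⋯ ∧ θ_{w (k-1)} ∧ 1`
span `E [⋀^Fin k]→L[𝕜] 𝕜'`. [cite: Warner1983, 2.6] -/
theorem span_wedgeWord_const_eq_top [CharZero 𝕜'] {ι' : Type*} [Fintype ι']
    (θ₀ : ι' → (E →L[𝕜] 𝕜)) (v : ι' → E)
    (h : ∑ i, (θ₀ i).smulRight (v i) = ContinuousLinearMap.id 𝕜 E) (k : ℕ) :
    wedgeWordSpan (fun i ↦ (θ₀ i).smulRight (1 : 𝕜'))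
      (ContinuousAlternatingMap.constOfIsEmpty 𝕜 E (Fin 0) (1 : 𝕜')) k = ⊤ := by
  set θ : ι' → (E →L[𝕜] 𝕜') := fun i ↦ (θ₀ i).smulRight (1 : 𝕜')
  set one : E [⋀^Fin 0]→L[𝕜] 𝕜' := ContinuousAlternatingMap.constOfIsEmpty 𝕜 E (Fin 0) (1 : 𝕜')
  -- every monomial `θ_w ∧ c` is `c(∅) • (θ_w ∧ 1)`
  have hc : ∀ (k : ℕ) (c : E [⋀^Fin 0]→L[𝕜] 𝕜') (w : Fin k → ι'),
      wedgeWord θ c k w = c Fin.elim0 • wedgeWord θ one k w := by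
    intro k
    induction k with
    | zero =>
      intro c w
      ext u
      simp [one, Subsingleton.elim u Fin.elim0]
    | succ k ih =>
      intro c w
      rw [wedgeWord_succ, wedgeWord_succ, ih, wedgeOne_smul]
  refine eq_top_iff.2 ?_
  rw [← span_wedgeWord_eq_top (𝕜' := 𝕜') (F := 𝕜') θ₀ v h k, Submodule.span_le]
  rintro _ ⟨c, w, rfl⟩
  rw [hc]
  exact Submodule.smul_mem _ _ (wedgeWord_mem_wedgeWordSpan θ one w)

end Literature.LinearAlgebra.Alternating

end
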